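import Summits.FinalStateConjecture.FinalStateConjecture.Statement
import HarnessLib

/-!
# Route StarvedNecks — split glue for `HonestFixedRadiusSettlingT` (item stmt-FinalStateConjecture-17575),
# crux-strategist s3 cut `far_label_cut`: censorship-with-far-labels | attraction (17684) | labelled upgrade

Support file of item stmt-FinalStateConjecture-17575 (`T = Theses.StarvedNecks.HonestFixedRadiusSettlingT`, the route's
generic import), THESES-FREE on purpose: its one theorem `honestFixedRadiusSettlingT_of_subs` has as hypotheses the TEXTS of the
three split children and as conclusion the TEXT of T, all verbatim (the let-bundles `Hc0`/`Hc`/`Hf` are token-identical with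
those of T and of item 17684, so the route file's `def`s unfold onto them by `δ`/`ζ`), so that a route-level
`route edit --split HonestFixedRadiusSettlingT --into … --glue-by <this theorem>` can import this module without a cycle.

The cut ("far_label_cut").  The registered line `Sketch` works one dynamical stub that is the whole rays-less crux
(`CoreReduction.T_iff_coreKick`, p138197); the strategist-s2 line (`CensorBridge`, p167138) separated censorship | attraction |
upgrade but read the third law on honest `C⁰` configurations (label rigidity at `C⁰` = a frontier question) and needed five
pieces.  Here hole labels are read at exactly ONE place, on FAR ANNULI at `C³`, where they are pointwise curvature scalars of
the spacetime (Abdelqader–Lake, PRD 91 (2015) 084017, §4: `m` and `a/m` as explicit functions of the Weyl invariants `I₁, I₂`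
and the gradient invariants `I₅, I₆, I₇`), and the cut has three pieces:

* child 1 `GenericCensoredLabelsFar` (GENERIC, chart-free): tame-Christodoulou-generically in the admissible class the datum is
  far-clean to order `(6,5)` on some end, has an MGHD, and every MGHD has complete `𝓘⁺`, only SUB-EXTREMAL labels on every
  honest fixed-radius `C⁰` configuration that is `C³`-settled on the far annuli `{t*ᵢ = τ, R₀ ≤ rᵢ ≤ R}` (third law as a
  threshold statement, Kehle–Unger arXiv:2402.10190), and pairwise distinct hole velocities on every honest `C⁴` configuration;
* child 2 `CensoredFixedRadiusSettle` = the text of item stmt-FinalStateConjecture-17684 (route GlobalAttraction) verbatim: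
  every censored MGHD of an admissible datum carries an honest fixed-radius `C⁰` configuration (Komech-type attraction);
* child 3 `HonestLabelledUpgrade` (DETERMINISTIC): for far-clean data, an honest fixed-radius `C⁰` configuration of a censored
  MGHD, together with the far-`C³` label hypothesis OF THAT DEVELOPMENT, upgrades to an honest fixed-radius `C⁴` configuration
  with the rays clause — itself the composition of a label-free far derivative gain and a sub-extremal red-shift upgrade
  (the registered line's stubs 3 and 4; seam `FarLabelCut.honestLabelledUpgrade_of_gain_redshift`, kernel-checked).

Proof of the glue: pointwise on the admissible class (child 2, then child 3 fed with child 1's label clause, then child 1's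
recession clause) followed by antitonicity of tame genericity in the exceptional set (`mono`, verbatim the route's `closes`).
No use of S (17574), E, F or 17673: the rays clause travels with the configurations.

References: Christodoulou, CQG 16 (1999) A23, p. A24 (genericity by positive codimension); Dafermos–Luk arXiv:1710.01722,
Conjecture 1; Kehle–Unger arXiv:2402.10190 (third law as a threshold statement); Abdelqader–Lake arXiv:1412.8757 §4 (local
mass/spin from curvature invariants); Dafermos–Rodnianski arXiv:0811.0354 §3–§7 (red-shift); Hintz arXiv:2606.28253
(nonlinear stability of sub-extremal Kerr, full range); Komech, *Attractors of Hamiltonian nonlinear PDEs* (2021) (model for 17684).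
-/


set_option linter.dupNamespace false

noncomputable section

open scoped Manifold ContDiff ENNReal Topology
open Filter Set Function Literature.Geometry.Lorentzian

namespace Summit.FinalStateConjecture.FinalStateConjecture.Theorems.StarvedNecks.FarLabelSplit

/-- Tame Christodoulou genericity (codimension `1`) is antitone in the exceptional set (the `mono` step of route
StarvedNecks' `closes`; Christodoulou, CQG 16 (1999) A23, p. A24: genericity = the exceptional set has positive codimension,
so enlarging the property shrinks the exceptional set). [cite: Christodoulou1999, p. A24] -/
theorem mono {X : Type} [TopologicalSpace X] [ChartedSpace E3 X] [IsManifold (𝓡 3) ∞ X]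
    {𝓓 : Set (InitialDataSet (𝓡 3) X)} {P Q : InitialDataSet (𝓡 3) X → Prop}
    (hPQ : ∀ D ∈ 𝓓, P D → Q D) (hP : InitialDataSet.IsTameChristodoulouGeneric 𝓓 P 1) :
    InitialDataSet.IsTameChristodoulouGeneric 𝓓 Q 1 := by
  intro d hd
  obtain ⟨e, F, hF, himm, h0, hinj, hmem, hE⟩ := hP d ⟨hd.1, fun h ↦ hd.2 (hPQ d hd.1 h)⟩
  exact ⟨e, F, hF, himm, h0, hinj, hmem, fun c hc hc' ↦ hE c hc ⟨hc'.1, fun h ↦ hc'.2 (hPQ _ hc'.1 h)⟩⟩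

/-- **Split glue for `Theses.StarvedNecks.HonestFixedRadiusSettlingT` (item stmt-FinalStateConjecture-17575), crux-strategist
s3 cut `far_label_cut`:** `GenericCensoredLabelsFar → CensoredFixedRadiusSettle → HonestLabelledUpgrade →
HonestFixedRadiusSettlingT`, every hypothesis and the conclusion being the route-item TEXTS verbatim (Theses-free, so that the
route file may import this module under `--glue-by`).  Proof: pointwise on the admissible class — attraction (17684) gives an
honest fixed-radius `C⁰` configuration of each censored MGHD; the labelled upgrade (far derivative gain, the generic third-law
clause READ at far-`C³`, red-shift) returns an honest `C⁴` configuration with the rays clause; the generic recession clause read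
at `C⁴` gives distinct four-velocities — then `mono` (antitonicity of tame genericity).  Dafermos–Luk arXiv:1710.01722
Conjecture 1 (the settling clause); Christodoulou CQG 16 (1999) p. A24 (genericity). [cite: DafermosLuk2017, Conjecture 1]
[cite: Christodoulou1999, p. A24] -/
theorem honestFixedRadiusSettlingT_of_subs :
    (open Literature.Geometry.Lorentzian in open scoped ContDiff ENNReal in let Hc0 := (fun (𝓢 : Spacetime.{0} 4) (O : Set 𝓢.carrier) (k : ℕ) (d : FinalStateDecomposition 𝓢 O k) (R₀ : ℝ) => let B := d.background; let t := fun i ↦ (B i).time; let r := fun i ↦ (B i).radius; let Ψ := d.chart; (∀ i, 100 * d.mass i ≤ R₀ ∧ 0 < ((d.motion i).1 : E4 ≃L[ℝ] E4) (E4.basisVector 0) 0) ∧ (∀ i (ϱ τ₂ : ℝ), R₀ ≤ ϱ → d.τ₀ < τ₂ → Ψ i '' {x | d.τ₀ < t i x.1 ∧ t i x.1 < τ₂ ∧ r i x.1 < ϱ} ⊆ 𝓢.metric.causalPast 𝓢.timeOrientation (Ψ i '' (B i).truncTimeSlab ϱ τ₂)) ∧ (∀ i (τ' : ℝ) (ϱ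 : ℝ → ℝ), Continuous ϱ → d.τ₀ < τ' → let A := Ψ i '' {x | τ' ≤ t i x.1 ∧ r i x.1 ≤ ϱ (t i x.1)}; closure A ∩ O ⊆ A) ∧ (∀ y : d.flatDomain, d.τ₀ < y.1 0 → 𝓢.timeOrientation.IsFutureDirected (mfderiv 𝓘(ℝ, E4) (𝓡 4) d.flatChart y (E4.basisVector 0)))); let Hc := ( fun (𝓢 : Spacetime.{0} 4) (O : Set 𝓢.carrier) (k : ℕ) (d : FinalStateDecomposition 𝓢 O k) (R₀ : ℝ) => let B := d.background; let t := fun i ↦ (B i).time; let r := fun i ↦ (B i).radius; let Ψ := d.chart; (∀ i, Kerr.IsSubextremal (d.mass i) (d.spin i) ∧ 100 * d.mass i ≤ R₀ ∧ 0 < ((d.motion i).1 : E4 ≃L[ℝ] E4) (E4.basisVector 0) 0) ∧ (∀ i (ϱ τ₂ : ℝ), R₀ ≤ ϱ → d.τ₀ < τ₂ → Ψ i '' {x | d.τ₀ < t i x.1 ∧ t i x.1 < τ₂ ∧ r i x.1 < ϱ} ⊆ 𝓢.metric.causalPast 𝓢.timeOrientation (Ψ i '' (B i).truncTimeSlab ϱ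 τ₂)) ∧ (∀ i (τ' : ℝ) (ϱ : ℝ → ℝ), Continuous ϱ → d.τ₀ < τ' → let A := Ψ i '' {x | τ' ≤ t i x.1 ∧ r i x.1 ≤ ϱ (t i x.1)}; closure A ∩ O ⊆ A) ∧ (∀ y : d.flatDomain, d.τ₀ < y.1 0 → 𝓢.timeOrientation.IsFutureDirected (mfderiv 𝓘(ℝ, E4) (𝓡 4) d.flatChart y (E4.basisVector 0))) ); let Hf := ( fun (𝓢 : Spacetime.{0} 4) (O : Set 𝓢.carrier) (k : ℕ) (d : FinalStateDecomposition 𝓢 O k) (R₀ : ℝ) => let B := d.background; let t := fun i ↦ (B i).time; let r := fun i ↦ (B i).radius; let Φ := d.flatChart; (∀ τ₂ : ℝ, d.τ₀ < τ₂ → Φ '' {y | d.τ₀ < y.1 0 ∧ y.1 0 < τ₂} ⊆ 𝓢.metric.causalPast 𝓢.timeOrientation (Φ '' (Minkowski.backgroundOn d.flatDomain).timeSlab τ₂)) ∧ (∀ τ' : ℝ, d.τ₀ < τ' → closure (Φ '' {y | τ' ≤ y.1 0 ∧ ∀ i, d.excision i (y.1 0) + 1 ≤ r i y.1}) ⊆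 Φ '' {y | τ' ≤ y.1 0}) ∧ (∀ i, ∃ T : ℝ, supCkENorm (Subtype.val '' {x : (B i).domain | T ≤ t i x.1 ∧ R₀ ≤ r i x.1 ∧ ∀ j, j ≠ i → r i x.1 ≤ r j x.1}) 0 (𝓢.deviationExtend (B i) (d.chart i)) ≤ ENNReal.ofReal (1 / (10 * ‖(((d.motion i).1 : E4 ≃L[ℝ] E4) : E4 →L[ℝ] E4)‖ ^ 2))) ); let Fc := (fun (𝓢 : Spacetime.{0} 4) (O : Set 𝓢.carrier) (k : ℕ) (d : FinalStateDecomposition 𝓢 O k) (R₀ : ℝ) => let B := d.background; let t := fun i ↦ (B i).time; let r := fun i ↦ (B i).radius; (∀ i (R : ℝ), Filter.Tendsto (fun τ : ℝ ↦ supCkENorm (Subtype.val '' {x : (B i).domain | t i x.1 = τ ∧ R₀ ≤ r i x.1 ∧ r i x.1 ≤ R}) 3 (𝓢.deviationExtend (B i) (d.chart i))) Filter.atTop (nhds 0))); ∀ (X : Type) [TopologicalSpace X] [ChartedSpace E3 X] [IsManifold (𝓡 3) ∞ X] [T2Space X] [SecondCountableTopology X] [ConnectedSpace X], InitialDataSet.IsTameChristodoulouGeneric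 (admissibleVacuumData X) (fun D ↦ (∃ (e : AFEnd X) (M : ℝ), e.IsStronglyAsymptoticallyFlatWith D M 1 2 6 5) ∧ (∃ 𝒟 : VacuumCauchyDevelopment D, 𝒟.IsMaximal) ∧ ∀ 𝒟 : VacuumCauchyDevelopment D, 𝒟.IsMaximal → HasCompleteNullInfinity 𝒟.toCauchyDevelopment ∧ (∀ (O : Set 𝒟.carrier) (d : FinalStateDecomposition 𝒟.toSpacetime O 0) (R₀ : ℝ), O = exteriorOf 𝒟.toCauchyDevelopment d.charted → RaysStayInClosure 𝒟.toCauchyDevelopment O → Hc0 𝒟.toSpacetime O 0 d R₀ → Hf 𝒟.toSpacetime O 0 d R₀ → Fc 𝒟.toSpacetime O 0 d R₀ → ∀ i, Kerr.IsSubextremal (d.mass i) (d.spin i)) ∧ (∀ (O : Set 𝒟.carrier) (d : FinalStateDecomposition 𝒟.toSpacetime O 4) (R₀ : ℝ), O = exteriorOf 𝒟.toCauchyDevelopment d.charted → Hc 𝒟.toSpacetime O 4 d R₀ → Hf 𝒟.toSpacetime O 4 d R₀ → (∀ i j : Fin d.N, i ≠ j → ((d.motion i).1 : E4 ≃L[ℝ]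 E4) (E4.basisVector 0) ≠ ((d.motion j).1 : E4 ≃L[ℝ] E4) (E4.basisVector 0)))) 1) →
    (open Literature.Geometry.Lorentzian in open scoped ContDiff ENNReal Manifold Topology in let Hc := (fun (𝓢 : Spacetime.{0} 4) (O : Set 𝓢.carrier) (k : ℕ) (d : FinalStateDecomposition 𝓢 O k) (R₀ : ℝ) => let B := d.background; let t := fun i ↦ (B i).time; let r := fun i ↦ (B i).radius; let Ψ := d.chart; (∀ i, 100 * d.mass i ≤ R₀ ∧ 0 < ((d.motion i).1 : E4 ≃L[ℝ] E4) (E4.basisVector 0) 0) ∧ (∀ i (ϱ τ₂ : ℝ), R₀ ≤ ϱ → d.τ₀ < τ₂ → Ψ i '' {x | d.τ₀ < t i x.1 ∧ t i x.1 < τ₂ ∧ r i x.1 < ϱ} ⊆ 𝓢.metric.causalPast 𝓢.timeOrientation (Ψ i '' (B i).truncTimeSlab ϱ τ₂)) ∧ (∀ i (τ' : ℝ) (ϱ : ℝ → ℝ), Continuous ϱ → d.τ₀ < τ' → let A := Ψ i '' {x | τ' ≤ t i x.1 ∧ r i x.1 ≤ ϱ (t i x.1)}; closure A ∩ O ⊆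 A) ∧ (∀ y : d.flatDomain, d.τ₀ < y.1 0 → 𝓢.timeOrientation.IsFutureDirected (mfderiv 𝓘(ℝ, E4) (𝓡 4) d.flatChart y (E4.basisVector 0)))); let Hf := (fun (𝓢 : Spacetime.{0} 4) (O : Set 𝓢.carrier) (k : ℕ) (d : FinalStateDecomposition 𝓢 O k) (R₀ : ℝ) => let B := d.background; let t := fun i ↦ (B i).time; let r := fun i ↦ (B i).radius; let Φ := d.flatChart; (∀ τ₂ : ℝ, d.τ₀ < τ₂ → Φ '' {y | d.τ₀ < y.1 0 ∧ y.1 0 < τ₂} ⊆ 𝓢.metric.causalPast 𝓢.timeOrientation (Φ '' (Minkowski.backgroundOn d.flatDomain).timeSlab τ₂)) ∧ (∀ τ' : ℝ, d.τ₀ < τ' → closure (Φ '' {y | τ' ≤ y.1 0 ∧ ∀ i, d.excision i (y.1 0) + 1 ≤ r i y.1}) ⊆ Φ '' {y | τ' ≤ y.1 0}) ∧ (∀ i, ∃ T : ℝ, supCkENorm (Subtype.val '' {x : (B i).domain | T ≤ t i x.1 ∧ R₀ ≤ r i x.1 ∧ ∀ j, j ≠ i → r i x.1 ≤ r j x.1})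 0 (𝓢.deviationExtend (B i) (d.chart i)) ≤ ENNReal.ofReal (1 / (10 * ‖(((d.motion i).1 : E4 ≃L[ℝ] E4) : E4 →L[ℝ] E4)‖ ^ 2)))); ∀ (X : Type) [TopologicalSpace X] [ChartedSpace E3 X] [IsManifold (𝓡 3) ((⊤ : ℕ∞) : WithTop ℕ∞) X] [T2Space X] [SecondCountableTopology X] [ConnectedSpace X], ∀ D ∈ admissibleVacuumData X, ∀ 𝒟 : VacuumCauchyDevelopment D, 𝒟.IsMaximal → Summit.FinalStateConjecture.HasCompleteNullInfinity 𝒟.toCauchyDevelopment → ∃ (O : Set 𝒟.carrier) (d : FinalStateDecomposition 𝒟.toSpacetime O 0) (R₀ : ℝ), O = Summit.FinalStateConjecture.exteriorOf 𝒟.toCauchyDevelopment d.charted ∧ Summit.FinalStateConjecture.RaysStayInClosure 𝒟.toCauchyDevelopment O ∧ Summit.FinalStateConjecture.IsFutureOriented d ∧ Hc 𝒟.toSpacetime O 0 d R₀ ∧ Hf 𝒟.toSpacetime O 0 d R₀) →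
    (open Literature.Geometry.Lorentzian in open scoped ContDiff ENNReal in let Hc0 := (fun (𝓢 : Spacetime.{0} 4) (O : Set 𝓢.carrier) (k : ℕ) (d : FinalStateDecomposition 𝓢 O k) (R₀ : ℝ) => let B := d.background; let t := fun i ↦ (B i).time; let r := fun i ↦ (B i).radius; let Ψ := d.chart; (∀ i, 100 * d.mass i ≤ R₀ ∧ 0 < ((d.motion i).1 : E4 ≃L[ℝ] E4) (E4.basisVector 0) 0) ∧ (∀ i (ϱ τ₂ : ℝ), R₀ ≤ ϱ → d.τ₀ < τ₂ → Ψ i '' {x | d.τ₀ < t i x.1 ∧ t i x.1 < τ₂ ∧ r i x.1 < ϱ} ⊆ 𝓢.metric.causalPast 𝓢.timeOrientation (Ψ i '' (B i).truncTimeSlab ϱ τ₂)) ∧ (∀ i (τ' : ℝ) (ϱ : ℝ → ℝ), Continuous ϱ → d.τ₀ < τ' → let A := Ψ i '' {x | τ' ≤ t i x.1 ∧ r i x.1 ≤ ϱ (t i x.1)}; closure A ∩ O ⊆ A) ∧ (∀ y : d.flatDomain, d.τ₀ < y.1 0 → 𝓢.timeOrientation.IsFutureDirected (mfderiv 𝓘(ℝ,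 E4) (𝓡 4) d.flatChart y (E4.basisVector 0)))); let Hc := ( fun (𝓢 : Spacetime.{0} 4) (O : Set 𝓢.carrier) (k : ℕ) (d : FinalStateDecomposition 𝓢 O k) (R₀ : ℝ) => let B := d.background; let t := fun i ↦ (B i).time; let r := fun i ↦ (B i).radius; let Ψ := d.chart; (∀ i, Kerr.IsSubextremal (d.mass i) (d.spin i) ∧ 100 * d.mass i ≤ R₀ ∧ 0 < ((d.motion i).1 : E4 ≃L[ℝ] E4) (E4.basisVector 0) 0) ∧ (∀ i (ϱ τ₂ : ℝ), R₀ ≤ ϱ → d.τ₀ < τ₂ → Ψ i '' {x | d.τ₀ < t i x.1 ∧ t i x.1 < τ₂ ∧ r i x.1 < ϱ} ⊆ 𝓢.metric.causalPast 𝓢.timeOrientation (Ψ i '' (B i).truncTimeSlab ϱ τ₂)) ∧ (∀ i (τ' : ℝ) (ϱ : ℝ → ℝ), Continuous ϱ → d.τ₀ < τ' → let A := Ψ i '' {x | τ' ≤ t i x.1 ∧ r i x.1 ≤ ϱ (t i x.1)}; closure A ∩ O ⊆ A) ∧ (∀ y : d.flatDomain, d.τ₀ < y.1 0 → 𝓢.timeOrientation.IsFutureDirected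 (mfderiv 𝓘(ℝ, E4) (𝓡 4) d.flatChart y (E4.basisVector 0))) ); let Hf := ( fun (𝓢 : Spacetime.{0} 4) (O : Set 𝓢.carrier) (k : ℕ) (d : FinalStateDecomposition 𝓢 O k) (R₀ : ℝ) => let B := d.background; let t := fun i ↦ (B i).time; let r := fun i ↦ (B i).radius; let Φ := d.flatChart; (∀ τ₂ : ℝ, d.τ₀ < τ₂ → Φ '' {y | d.τ₀ < y.1 0 ∧ y.1 0 < τ₂} ⊆ 𝓢.metric.causalPast 𝓢.timeOrientation (Φ '' (Minkowski.backgroundOn d.flatDomain).timeSlab τ₂)) ∧ (∀ τ' : ℝ, d.τ₀ < τ' → closure (Φ '' {y | τ' ≤ y.1 0 ∧ ∀ i, d.excision i (y.1 0) + 1 ≤ r i y.1}) ⊆ Φ '' {y | τ' ≤ y.1 0}) ∧ (∀ i, ∃ T : ℝ, supCkENorm (Subtype.val '' {x : (B i).domain | T ≤ t i x.1 ∧ R₀ ≤ r i x.1 ∧ ∀ j, j ≠ i → r i x.1 ≤ r j x.1}) 0 (𝓢.deviationExtend (B i) (d.chart i)) ≤ ENNReal.ofReal (1 / (10 * ‖(((d.motion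 i).1 : E4 ≃L[ℝ] E4) : E4 →L[ℝ] E4)‖ ^ 2))) ); let Fc := (fun (𝓢 : Spacetime.{0} 4) (O : Set 𝓢.carrier) (k : ℕ) (d : FinalStateDecomposition 𝓢 O k) (R₀ : ℝ) => let B := d.background; let t := fun i ↦ (B i).time; let r := fun i ↦ (B i).radius; (∀ i (R : ℝ), Filter.Tendsto (fun τ : ℝ ↦ supCkENorm (Subtype.val '' {x : (B i).domain | t i x.1 = τ ∧ R₀ ≤ r i x.1 ∧ r i x.1 ≤ R}) 3 (𝓢.deviationExtend (B i) (d.chart i))) Filter.atTop (nhds 0))); ∀ (X : Type) [TopologicalSpace X] [ChartedSpace E3 X] [IsManifold (𝓡 3) ∞ X] [T2Space X] [SecondCountableTopology X] [ConnectedSpace X], ∀ D ∈ admissibleVacuumData X, (∃ (e : AFEnd X) (M : ℝ), e.IsStronglyAsymptoticallyFlatWith D M 1 2 6 5) → ∀ 𝒟 : VacuumCauchyDevelopment D, 𝒟.IsMaximal → HasCompleteNullInfinity 𝒟.toCauchyDevelopment → ∀ (O₀ : Set 𝒟.carrier) (d₀ : FinalStateDecomposition 𝒟.toSpacetime O₀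 0) (R₀ : ℝ), O₀ = exteriorOf 𝒟.toCauchyDevelopment d₀.charted → RaysStayInClosure 𝒟.toCauchyDevelopment O₀ → IsFutureOriented d₀ → Hc0 𝒟.toSpacetime O₀ 0 d₀ R₀ → Hf 𝒟.toSpacetime O₀ 0 d₀ R₀ → (∀ (O : Set 𝒟.carrier) (d : FinalStateDecomposition 𝒟.toSpacetime O 0) (R₀ : ℝ), O = exteriorOf 𝒟.toCauchyDevelopment d.charted → RaysStayInClosure 𝒟.toCauchyDevelopment O → Hc0 𝒟.toSpacetime O 0 d R₀ → Hf 𝒟.toSpacetime O 0 d R₀ → Fc 𝒟.toSpacetime O 0 d R₀ → ∀ i, Kerr.IsSubextremal (d.mass i) (d.spin i)) → ∃ (O : Set 𝒟.carrier) (d : FinalStateDecomposition 𝒟.toSpacetime O 4) (R₂ : ℝ), O = exteriorOf 𝒟.toCauchyDevelopment d.charted ∧ RaysStayInClosure 𝒟.toCauchyDevelopment O ∧ Hc 𝒟.toSpacetime O 4 d R₂ ∧ Hf 𝒟.toSpacetime O 4 d R₂) →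
    (open Literature.Geometry.Lorentzian in open scoped ContDiff ENNReal in let Hc := ( fun (𝓢 : Spacetime.{0} 4) (O : Set 𝓢.carrier) (k : ℕ) (d : FinalStateDecomposition 𝓢 O k) (R₀ : ℝ) => let B := d.background; let t := fun i ↦ (B i).time; let r := fun i ↦ (B i).radius; let Ψ := d.chart; (∀ i, Kerr.IsSubextremal (d.mass i) (d.spin i) ∧ 100 * d.mass i ≤ R₀ ∧ 0 < ((d.motion i).1 : E4 ≃L[ℝ] E4) (E4.basisVector 0) 0) ∧ (∀ i (ϱ τ₂ : ℝ), R₀ ≤ ϱ → d.τ₀ < τ₂ → Ψ i '' {x | d.τ₀ < t i x.1 ∧ t i x.1 < τ₂ ∧ r i x.1 < ϱ} ⊆ 𝓢.metric.causalPast 𝓢.timeOrientation (Ψ i '' (B i).truncTimeSlab ϱ τ₂)) ∧ (∀ i (τ' : ℝ) (ϱ : ℝ → ℝ), Continuous ϱ → d.τ₀ < τ' → let A := Ψ i '' {x | τ' ≤ t i x.1 ∧ r i x.1 ≤ ϱ (t i x.1)}; closure A ∩ O ⊆ A) ∧ (∀ y : d.flatDomain, d.τ₀ < y.1 0 → 𝓢.timeOrientation.IsFutureDirected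 (mfderiv 𝓘(ℝ, E4) (𝓡 4) d.flatChart y (E4.basisVector 0))) ); let Hf := ( fun (𝓢 : Spacetime.{0} 4) (O : Set 𝓢.carrier) (k : ℕ) (d : FinalStateDecomposition 𝓢 O k) (R₀ : ℝ) => let B := d.background; let t := fun i ↦ (B i).time; let r := fun i ↦ (B i).radius; let Φ := d.flatChart; (∀ τ₂ : ℝ, d.τ₀ < τ₂ → Φ '' {y | d.τ₀ < y.1 0 ∧ y.1 0 < τ₂} ⊆ 𝓢.metric.causalPast 𝓢.timeOrientation (Φ '' (Minkowski.backgroundOn d.flatDomain).timeSlab τ₂)) ∧ (∀ τ' : ℝ, d.τ₀ < τ' → closure (Φ '' {y | τ' ≤ y.1 0 ∧ ∀ i, d.excision i (y.1 0) + 1 ≤ r i y.1}) ⊆ Φ '' {y | τ' ≤ y.1 0}) ∧ (∀ i, ∃ T : ℝ, supCkENorm (Subtype.val '' {x : (B i).domain | T ≤ t i x.1 ∧ R₀ ≤ r i x.1 ∧ ∀ j, j ≠ i → r i x.1 ≤ r j x.1}) 0 (𝓢.deviationExtend (B i) (d.chart i)) ≤ ENNReal.ofReal (1 / (10 * ‖(((d.motion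 i).1 : E4 ≃L[ℝ] E4) : E4 →L[ℝ] E4)‖ ^ 2))) ); ∀ (X : Type) [TopologicalSpace X] [ChartedSpace E3 X] [IsManifold (𝓡 3) ∞ X] [T2Space X] [SecondCountableTopology X] [ConnectedSpace X], InitialDataSet.IsTameChristodoulouGeneric (admissibleVacuumData X) (fun D ↦ (∃ 𝒟 : VacuumCauchyDevelopment D, 𝒟.IsMaximal) ∧ ∀ 𝒟 : VacuumCauchyDevelopment D, 𝒟.IsMaximal → HasCompleteNullInfinity 𝒟.toCauchyDevelopment ∧ ∃ (O : Set 𝒟.carrier) (d : FinalStateDecomposition 𝒟.toSpacetime O 4) (R₀ : ℝ), O = exteriorOf 𝒟.toCauchyDevelopment d.charted ∧ RaysStayInClosure 𝒟.toCauchyDevelopment O ∧ Hc 𝒟.toSpacetime O 4 d R₀ ∧ Hf 𝒟.toSpacetime O 4 d R₀ ∧ (∀ i j : Fin d.N, i ≠ j → ((d.motion i).1 : E4 ≃L[ℝ] E4) (E4.basisVector 0) ≠ ((d.motion j).1 : E4 ≃L[ℝ] E4) (E4.basisVector 0))) 1) := by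
  intro h₁ hA hU; dsimp only; intro X _ _ _ _ _ _
  refine mono ?_ (h₁ X)
  rintro D hD ⟨hclean, hex, hall⟩
  refine ⟨hex, fun 𝒟 h𝒟 ↦ ?_⟩
  obtain ⟨hscri, hLab, hdvLab⟩ := hall 𝒟 h𝒟
  -- attraction (item 17684): an honest fixed-radius `C⁰` configuration of this censored MGHD
  obtain ⟨O₀, d₀, R₀, hO₀, hrays₀, hfo₀, hcore₀, hfar₀⟩ := hA X D hD 𝒟 h𝒟 hscri
  -- labelled upgrade: far gain, the generic THIRD-LAW clause read at far-`C³`, red-shift — an honest `C⁴` configuration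
  obtain ⟨O, d, R₂, hO, hrays, hcore, hfar⟩ :=
    hU X D hD hclean 𝒟 h𝒟 hscri O₀ d₀ R₀ hO₀ hrays₀ hfo₀ hcore₀ hfar₀ hLab
  -- the generic RECESSION clause, read at `C⁴` (T's own format): pairwise distinct four-velocities
  exact ⟨hscri, O, d, R₂, hO, hrays, hcore, hfar, hdvLab O d R₂ hO hcore hfar⟩

end Summit.FinalStateConjecture.FinalStateConjecture.Theorems.StarvedNecks.FarLabelSplit

end
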